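import Summits.QuantumFields.YangMills.Theorems.UnitScaleTiltProp7OneFormGreenBlockGradientAllMembers
import Summits.QuantumFields.YangMills.Theorems.UnitScaleTiltProp7OneFormGreenBlockGradientFamily
import HarnessLib

/-!
# Route `UnitScaleTilt`, crux K1 «MinimiserStabilityRegPr» (stmt-QuantumFields-19200), EX face, norm_G road — **(∇0)-K AND (∇0)-FAMILY, ROOM-FREE EDITIONS (R-G2)** — F2
# ✓`Prop7OneFormGreenBlockGradientKFree.gradient_GT_DeltaEtaSlot_kfree` with the `hroom` binder DELETED and F3 ✓`Prop7OneFormGreenBlockGradientFamily.gradient_GT_DeltaEtaSlot_family` with the conjunct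
# `2 * (12 * i.1.1.L ^ (i.1.2.2 - i.1.2.1) + 5) ≤ (i.1.1.P i.1.2.2).sitesPerDir 0 →` DELETED (same `∃ αG BG` head, same witnesses), re-run over R-G1 ✓`norm_nabla115_GT_le_of_sup_allMembers`
# (⟸ R-D1 ⟸ px5 g15's R1).  px17 g12's `hG0` letter member-free and L-only-family WITHOUT the no-wrap room.  (width seat `ym3-torus-px21` g16; GENERATED by `gen/gen_rg.py`, one token each,
# each edit asserted once; F2's `CN_mono` IMPORTED, not re-typed.)

Cell `ym3-torus` (HUMAN RULING D-0037; rung R3 = SU(2) YM₃ on T³ — NOT d = 4, NOT infinite volume, NOT a mass gap, NOT Clay).  THEOREMS ONLY (0 `def`, 0 `sorry`);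
`--supports stmt-QuantumFields-19200 --as helper`; count-neutral.

WHAT IS PROVED (ns `Summit.QuantumFields.YangMills.Theorems.Prop7OneFormGreenBlockGradientFamilyAllMembers`).
* ★★★ `gradient_GT_DeltaEtaSlot_kfree_allMembers` — F2's statement minus `hroom`, member-free `C_∇⋆` BYTE-IDENTICAL; decl-local `set_option maxHeartbeats 400000 in` INHERITED VERBATIM from F2
  (README class, disclosed there: fails 200k, passes 300k).
* ★★★ `gradient_GT_DeltaEtaSlot_family_allMembers` — F3's `∃ αG BG` package minus the ROOM conjunct, same witnesses; decl-local 400k INHERITED VERBATIM from F3.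
HYP-SAT (★★OWNER RULING №42): F2∕F3's letters minus the room.  HONEST SCOPE: mechanical re-runs; CONDITIONAL on the displayed letters ((γ) `hco`, `hk_D`, `Lift`, budgets ∕ cap);
nothing of (∇1), `norm_G`, the EX rows, EX, 19200 or the rung is proved; no summit is proved by a helper; the Yang–Mills mass gap is NOT proved.

References: T. Bałaban, CMP **99** (1985) 389–434 [Balaban1985BackgroundPropagators] ((3.3) p.391, Thm 3.1 (3.42)–(3.47) pp.397–399, (3.49) p.399, Thm 3.3 (3.47)–(3.48) p.398,
Thm 3.11 p.416, Thm 3.12 p.423); CMP **102** (1985) 277–309 [Balaban1985Variational] (Thm 1 p.279, (19) p.281, (115)–(117) pp.294–295).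
-/

set_option autoImplicit false

noncomputable section

open scoped Matrix.Norms.L2Operator BigOperators InnerProductSpace ComplexConjugate

namespace Summit.QuantumFields.YangMills.Theorems.Prop7OneFormGreenBlockGradientFamilyAllMembers

open Literature.MathematicalPhysics.QuantumFieldTheory.Balaban1983to89
open Literature.MathematicalPhysics.QuantumFieldTheory.Balaban1983to89.T3ContinuumYM3Torus
open Literature.MathematicalPhysics.QuantumFieldTheory.Balaban1983to89.T3PrintedRegularMinimiser (RegPr)
open B15DeterminingSets (embIter)
open T3SectALandauChart (formComp bgUnits eta eta_pos)
open B9SectCLatticeCarrier (Bond)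
open B9Eq311L2Pairing (WL2)
open B11Eq103H1Complex (BondL2K)
open B5Eq118OneStroke (iterBlockOf)
open Summit.QuantumFields.YangMills.Theorems.Prop8Chart (emlIterU)
open Summit.QuantumFields.YangMills.Theorems.Prop7SectET3Transport (periodsT3 bondEquiv)
open Summit.QuantumFields.YangMills.Theorems.Prop7SectET3HilbertLetters (W₂ frobEquiv toL2 toL2S DL2 DstarL2)
open Summit.QuantumFields.YangMills.Theorems.Prop7SectET3WilsonHessian (DeltaEtaSlot)
open Summit.QuantumFields.YangMills.Theorems.Prop7SectET3GaugeProjector (RS)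
open Summit.QuantumFields.YangMills.Theorems.Prop7SectET3CurvedPropagators (laplaceA Qk GT PosOnto)
open Summit.QuantumFields.YangMills.Theorems.Prop7OneFormAgmonPhaseClass (hVconj_phaseClass_of_letters)
open Summit.QuantumFields.YangMills.Theorems.Prop7QkPenaltyKernelRowOfRegPr (hkQ_of_regPr)
open Summit.QuantumFields.YangMills.Theorems.Prop7QkAdjointSupRowOfRegPr (norm_Qk_le_of_regPr)
open Summit.QuantumFields.YangMills.Theorems.Prop7QkOntoOfRegPr (surjective_Qk_of_regPr)
open Summit.QuantumFields.YangMills.Theorems.Prop7OneFormRemainderFloorOfLift (hVlow_abs_of_lift)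
open Summit.QuantumFields.YangMills.Theorems.Prop7OneFormGreenSupBound (norm_symm_GT_apply_le_of_blockSupport)
open Summit.QuantumFields.YangMills.Theorems.Prop7OneFormGreenKFreeNumerics (sqrt_vol_mul_sqrt_mass_eq twoA₂_le_kfree thetaV_le_kfree hsmall_le_half rbudget_le theta_ge_half_of_budgets CV_abs_le)
open Summit.QuantumFields.YangMills.Theorems.Prop7CurvedMemberLocalGradient (exists_curved_localGradient)
open Summit.QuantumFields.YangMills.Theorems.AxialGaugeChartGlue (norm_bgOfCfg_axialT_sub_le)
open B11Eq111FrakG (nabla115)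
open Summit.QuantumFields.YangMills.Theorems.Prop7SectET3Transport (bgOfCfg)
open Summit.QuantumFields.YangMills.Theorems.Prop7OneFormGreenBlockDivergenceKFree (words_le_kfree exp_mul_kappa_le)
open Summit.QuantumFields.YangMills.Theorems.Prop7OneFormGreenBlockGradientAllMembers (norm_nabla115_GT_le_of_sup_allMembers)
open Literature.MathematicalPhysics.QuantumFieldTheory.Balaban1983to89.T3PrintedMinimiserExistence (regPr_mono)
open B11Eq103H1Complex (BondL2K projR)
open Summit.QuantumFields.YangMills.Theorems.Prop7SectET3HilbertLetters (W₂ frobEquiv toL2 toL2S DL2 DstarL2 covLapSite)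
open Summit.QuantumFields.YangMills.Theorems.Prop7OneFormCoerciveHolds (hco_DeltaEtaSlot_exists)
open Summit.QuantumFields.YangMills.Theorems.Prop7KernelRow349AllMembers (kernelRow349_allMembers_exists)
open Summit.QuantumFields.YangMills.Theorems.Prop7LiftOfRSEqPrintProjector (RS_eq_projR_iff_lift)
open Summit.QuantumFields.YangMills.Theorems.Prop7NSIntertwinerOfRecord (exists_intertwiner_of_regPr)
open Summit.QuantumFields.YangMills.Theorems.Prop7OneFormGreenBlockGradientKFree (CN_mono)

/-! ## §1 (∇0)-K at every member (no room) -/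

section Member

variable (F : T3Family) {n K : ℕ} (h : n ≤ K) (c₀ cB : ℝ) [Fact (0 < c₀)] [Fact (0 < cB)]

set_option maxHeartbeats 400000 in
/-- ★★★ **(∇0)-K: THE (115)-GRADIENT ROW OF `G₀` ON SUP-BOUNDED SOURCES, UNDER `Lift`, MEMBER-FREE CONSTANT** — F1 ✓`norm_nabla115_GT_le_of_sup` with every letter FED as in ✓(dκ)-K
`divergence_GT_DeltaEtaSlot_kfree` (hypotheses VERBATIM), concluding px17 g12's `hG0` binder text with `BG := C_∇⋆·(2(1+1∕κ₁))³`, `κ₁ = min r ¼ ∕ 2`, `C_∇⋆` member-free (printed).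
[cite: Balaban1985BackgroundPropagators, (3.3) p.391, Thm 3.1 (3.42)–(3.47) pp.397–399, (3.49) p.399, Thm 3.11 p.416, Thm 3.12 p.423; Balaban1985Variational, (19) p.281, (115)–(117) pp.294–295] -/
theorem gradient_GT_DeltaEtaSlot_kfree_allMembers (hnK : n < K) {ε₀ : ℝ} (hε₀ : 0 < ε₀) (hWε : 10 ^ 12 * (F.L : ℝ) ^ 3 * ε₀ ≤ 1)
    (hε10 : 10 ^ 10 * (F.L : ℝ) ^ 6 * ε₀ ≤ 1) (hwin : 13 * 10 ^ 14 * (F.L : ℝ) ^ 3 * ε₀ ≤ 1)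
    (U₀ : GaugeField (F.P K) 0 (Matrix.specialUnitaryGroup (Fin 2) ℂ)) (hreg : RegPr F n K ε₀ U₀)
    (hlift : ∀ cf : Site (F.P K) (K - n) → Matrix (Fin 2) (Fin 2) ℂ,
        (∀ e : PBond (F.P K) (K - n), cf e.src = ((emlIterU (K - n) (bgUnits F K U₀) e : (Matrix (Fin 2) (Fin 2) ℂ)ˣ) : Matrix (Fin 2) (Fin 2) ℂ) * cf e.tgt *
          (((emlIterU (K - n) (bgUnits F K U₀) e)⁻¹ : (Matrix (Fin 2) (Fin 2) ℂ)ˣ) : Matrix (Fin 2) (Fin 2) ℂ)) →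
        ∃ l₀ : Site (F.P K) 0 → Matrix (Fin 2) (Fin 2) ℂ,
          (∀ b : PBond (F.P K) 0, l₀ b.src = ((bgUnits F K U₀ b : (Matrix (Fin 2) (Fin 2) ℂ)ˣ) : Matrix (Fin 2) (Fin 2) ℂ) * l₀ b.tgt * (((bgUnits F K U₀ b)⁻¹ : (Matrix (Fin 2) (Fin 2) ℂ)ˣ) : Matrix (Fin 2) (Fin 2) ℂ)) ∧
          ∀ y : Site (F.P K) (K - n), l₀ (embIter (K - n) y) = cf y)
    {a a₁ : ℝ} (ha : 0 ≤ a) (ha₁ : a ≤ a₁ * (c₀ / cB) * ((F.L : ℝ) ^ (K - n)) ^ 3)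
    {γ : ℝ} (hγ : 0 < γ) (hco : ∀ v : BondL2K ℂ 3 (periodsT3 F K) c₀ W₂, γ * ‖v‖ ^ 2 ≤ RCLike.re ⟪v, laplaceA F n K h c₀ cB a (DeltaEtaSlot F n K c₀) U₀ v⟫_ℂ)
    {CK δK : ℝ} (hCK : 0 ≤ CK) (hδK : 0 < δK)
    (hkD : ∀ (b : PBond (F.P K) 0) (Z : Matrix (Fin 2) (Fin 2) ℂ) (bd : PBond (F.P K) 0),
      ‖(toL2 F K c₀).symm (DL2 F n K c₀ U₀ (DstarL2 F n K c₀ U₀ (toL2 F K c₀ (Pi.single b Z))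
          - RS F n K h c₀ cB U₀ (DstarL2 F n K c₀ U₀ (toL2 F K c₀ (Pi.single b Z))))) bd‖
        ≤ CK * ((F.L : ℝ) ^ (K - n))⁻¹ ^ 3 * Real.exp (-(δK * (Site.tdist (P := F.P K) (iterBlockOf (K - n) b.src) (iterBlockOf (K - n) bd.src) : ℝ))) * ‖Z‖)
    {r ε : ℝ} (hr : 0 < r) (hr4 : r ≤ 1 / 4) (hrδ : r ≤ δK / 2) (hε : 0 < ε) (hε8 : ε ≤ 1 / 8)
    (hεC : ε * (32 * Real.sqrt 2 * 648 + (33 / 8 : ℝ) ^ 2 * (600 * (27 / 4 : ℝ) ^ 6)) ≤ γ / 8) (hrγ : r ≤ γ * ε / 48)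
    (hrT : r * (5000 * a₁ + 27 * Real.sqrt 2 * CK * (2 * (1 + 4 / δK)) ^ 3 / min 1 (δK / 4)) ≤ γ / 16) (hαγ : 10 ^ 5 * ε₀ ≤ γ / 16)
    (hsmall : exists_curved_localGradient.choose * ((48 * ε₀) * (6 * Real.sqrt 2 * Real.sqrt 10 + 6 * Real.sqrt 2)) * Real.exp (51 / 8) ≤ 1 / 2) :
    ∀ (X : PBond (F.P K) 0 → Matrix (Fin 2) (Fin 2) ℂ) (s : ℝ), (∀ b, ‖X b‖ ≤ s) →
      ‖nabla115 (((F.L : ℝ)⁻¹) ^ (K - n)) (bgOfCfg F K U₀)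
          (fun q : Bond 3 (periodsT3 F K) => (toL2 F K c₀).symm (GT F n K h c₀ cB a (DeltaEtaSlot F n K c₀) U₀ (toL2 F K c₀ X)) ((bondEquiv F K).symm q))‖
        ≤ ((2 * ((exists_curved_localGradient.choose * (((Real.sqrt 2 * (2 * ((Real.sqrt 2 + Real.sqrt 2 * ((50 * a₁ * Real.exp δK + CK) * (3 * Real.sqrt 2) * (Real.exp (6 * r) * (2 / γ)) * (2 * (1 + 2 / δK)) ^ 3)) * (8 * Real.exp (3 * r)) * 14 + 36 * (Real.sqrt (8 * Real.exp (3 * r) * (2 * (1 + 1 / r)) ^ 3) * (Real.exp (6 * r) * (2 / γ)))))) * Real.exp (51 / 8)) * (2 + 2 * Real.sqrt 2 * (4 * ε₀ * (3 + 2457 * norm_bgOfCfg_axialT_sub_le.choose)) + (24 * Real.sqrt 10 + 48) * (48 * ε₀) ^ 2) + (Real.sqrt 2 * ((32 * ε₀ * ((2 * ((Real.sqrt 2 + Real.sqrt 2 * ((50 * a₁ * Real.exp δK + CK) * (3 * Real.sqrt 2) * (Real.exp (6 * r) * (2 / γ)) * (2 * (1 + 2 / δK)) ^ 3)) * (8 *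 Real.exp (3 * r)) * 14 + 36 * (Real.sqrt (8 * Real.exp (3 * r) * (2 * (1 + 1 / r)) ^ 3) * (Real.exp (6 * r) * (2 / γ))))) * Real.exp (5 / 8))) + (CK * (3 * Real.sqrt 2) * (Real.exp (6 * r) * (2 / γ)) * (2 * (1 + 2 / δK)) ^ 3) + ((50 * a₁ * Real.exp δK) * (3 * Real.sqrt 2) * (Real.exp (6 * r) * (2 / γ)) * (2 * (1 + 2 / δK)) ^ 3) + 1)) * Real.exp (51 / 8)) + 2 * Real.sqrt 2 * (48 * ε₀) * ((Real.sqrt 2 * (2 * ((Real.sqrt 2 + Real.sqrt 2 * ((50 * a₁ * Real.exp δK + CK) * (3 * Real.sqrt 2) * (Real.exp (6 * r) * (2 / γ)) * (2 * (1 + 2 / δK)) ^ 3)) * (8 * Real.exp (3 * r)) * 14 + 36 * (Real.sqrt (8 * Real.exp (3 * r) * (2 * (1 + 1 / r)) ^ 3) * (Real.exp (6 * r) * (2 / γ)))))) * Real.exp (51 / 8))))) * (2 * (1 + 1 / (min r (1 / 4) / 2))) ^ 3) * s := by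
  intro X s hX
  have hc₀ : 0 < c₀ := Fact.out
  have hcB : 0 < cB := Fact.out
  have hd : (F.P K).d = 3 := rfl
  have hL2 : (2 : ℝ) ≤ F.L := by exact_mod_cast F.hL.2
  have hLr : (1 : ℝ) ≤ F.L := le_trans one_le_two hL2
  have hε5 : ε₀ ≤ (10 : ℝ)⁻¹ ^ 5 := by
    have h1 : 10 ^ 12 * ε₀ ≤ 10 ^ 12 * (F.L : ℝ) ^ 3 * ε₀ := by
      have hL3 : (1 : ℝ) ≤ (F.L : ℝ) ^ 3 := one_le_pow₀ hLr
      nlinarith [hε₀.le]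
    have h2 : 10 ^ 12 * ε₀ ≤ 1 := h1.trans hWε
    rw [inv_pow]
    rw [le_inv_comm₀ hε₀ (by positivity)]
    calc (10 : ℝ) ^ 5 ≤ 10 ^ 12 := by norm_num
      _ ≤ ε₀⁻¹ := by rw [le_inv_comm₀ (by positivity) hε₀]; exact (le_div_iff₀' (by positivity)).mpr (by linarith) |>.trans (le_of_eq (one_div _))
  have hε1 : ε₀ ≤ 1 := hε5.trans (by norm_num)
  have hεle1 : ε ≤ 1 := by linarith
  -- the four budgets ⟹ `Θ ≥ γ∕2`; the value window
  have hθ := thetaV_le_kfree hd hLr (K - n) hc₀ hcB ha ha₁ hCK hδK hr hr4 hrδ hε₀.le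
  have hθ8 := hθ.trans (show r * (5000 * a₁ + 27 * Real.sqrt 2 * CK * (2 * (1 + 4 / δK)) ^ 3 / min 1 (δK / 4)) + 10 ^ 5 * ε₀ ≤ γ / 8 by linarith)
  have hεC' := (mul_le_mul_of_nonneg_left (CV_abs_le hd hε1) hε.le).trans hεC
  have hR := (rbudget_le hγ.le hr hr4 hε (by linarith) hrγ).trans (show γ / 16 ≤ γ / 8 by linarith [hγ.le])
  have hΘ := theta_ge_half_of_budgets hγ.le hε8 hεC' hR hθ8
  have hΘpos := lt_of_lt_of_le (by positivity : (0 : ℝ) < γ / 2) hΘ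
  have hS := hsmall_le_half hr4 hε₀.le hε5
  have hSV := lt_of_le_of_lt hS (by norm_num : (1 : ℝ) / 2 < 1)
  have hrμ : r < δK := by linarith
  have hCkD : 0 ≤ CK * ((F.L : ℝ) ^ (K - n))⁻¹ ^ 3 := by positivity
  have hdr : 0 < δK - r := by linarith
  have hS30 : 0 ≤ (2 * (1 + 1 / (δK - r))) ^ 3 := pow_nonneg (by have := div_nonneg zero_le_one hdr.le; linarith) 3
  have hCg := exists_curved_localGradient.choose_spec.1
  have hC := norm_bgOfCfg_axialT_sub_le.choose_spec.1
  have e4B : (4 : ℝ) * ((Real.sqrt 2 + Real.sqrt 2 * ((50 * a₁ * Real.exp δK + CK) * (3 * Real.sqrt 2) * (Real.exp (6 * r) * (2 / γ)) * (2 * (1 + 2 / δK)) ^ 3)) * (8 * Real.exp (3 * r)) * 14 + 36 * (Real.sqrt (8 * Real.exp (3 * r) * (2 * (1 + 1 / r)) ^ 3) * (Real.exp (6 * r) * (2 / γ)))) = 2 * (2 * ((Real.sqrt 2 + Real.sqrt 2 * ((50 * a₁ * Real.exp δK + CK) * (3 * Real.sqrt 2) * (Real.exp (6 * r) * (2 /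 γ)) * (2 * (1 + 2 / δK)) ^ 3)) * (8 * Real.exp (3 * r)) * 14 + 36 * (Real.sqrt (8 * Real.exp (3 * r) * (2 * (1 + 1 / r)) ^ 3) * (Real.exp (6 * r) * (2 / γ))))) := by ring
  -- numerics: every member-dependent atom of `C_D` under its K-free majorant (pure reals, before the big terms enter the context)
  have hA := twoA₂_le_kfree hd hLr (K - n) hc₀ hcB ha ha₁ hCK hδK hr hr4 hrδ hγ hΘ hε₀.le hε5
  have hAV := le_of_mul_le_mul_left (hA.trans_eq e4B) (two_pos : (0 : ℝ) < 2)
  obtain ⟨hWD, hWQ⟩ := words_le_kfree hd hLr (K - n) hc₀ hcB ha ha₁ hCK hδK hr hrδ hγ hΘ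
  -- the fed letters (A2i's knit)
  have hp : PosOnto F n K h c₀ cB a (DeltaEtaSlot F n K c₀) U₀ :=
    ⟨fun v hv => lt_of_lt_of_le (mul_pos hγ (pow_pos (norm_pos_iff.mpr hv) 2)) (hco v), surjective_Qk_of_regPr F h hnK c₀ cB hreg hwin⟩
  have hQ : ∀ v : BondL2K ℂ 3 (periodsT3 F K) c₀ W₂, ‖Qk F n K h c₀ cB U₀ v‖ ≤ (6 * Real.sqrt (cB / c₀) * Real.sqrt (((F.L : ℝ) ^ (K - n))⁻¹ ^ 3)) * ‖v‖ :=
    fun v => norm_Qk_le_of_regPr F h c₀ cB hε₀ hε10 hWε U₀ hreg v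
  have hVconj := hVconj_phaseClass_of_letters F h c₀ cB (a := a) hε₀ hε10 hWε U₀ hreg ha hr.le hrμ hCkD hkD hQ
  have hVlow := hVlow_abs_of_lift F h c₀ cB (a := a) hnK hε₀ hWε U₀ hreg ha hlift
  have hkQ := hkQ_of_regPr F h c₀ cB hε₀ hε10 hWε U₀ hreg ha (le_of_lt (hr.trans hrμ))
  -- the gradient margin at `κ₁ ≤ ⅛`
  have hsmallκ : exists_curved_localGradient.choose * ((48 * ε₀) * (6 * Real.sqrt 2 * Real.sqrt 10 + 6 * Real.sqrt 2)) * Real.exp (51 * (min r (1 / 4) / 2)) ≤ 1 / 2 :=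
    (mul_le_mul_of_nonneg_left (exp_mul_kappa_le (r := r) (by norm_num : (0 : ℝ) ≤ 51))
      (mul_nonneg exists_curved_localGradient.choose_spec.1 (by positivity))).trans hsmall
  -- the decayed VALUE row (px16 §3) as a letter quantified over block-supported sources, fed
  have hvalb := fun (Y : PBond (F.P K) 0 → Matrix (Fin 2) (Fin 2) ℂ) (z : Site (F.P K) (K - n)) (hYz : ∀ b, Y b ≠ 0 → iterBlockOf (K - n) b.src = z)
      (t : ℝ) (ht : 0 ≤ t) (hY : ∀ b, ‖Y b‖ ≤ t) (bd : PBond (F.P K) 0) =>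
    norm_symm_GT_apply_le_of_blockSupport (h := h) (cB := cB) (a := a) hnK.le hε₀.le U₀ hreg hp hr hε hεle1 hco hVlow hVconj hΘpos hCkD
      (by positivity) hrμ hkD hkQ hSV Y z hYz ht hY bd
  -- (∇0) at the member with every letter fed
  have main := norm_nabla115_GT_le_of_sup_allMembers F c₀ U₀ (h := h) (cB := cB) (a := a) hnK.le hε₀ hε1 hreg hp hr hε hεle1 hco hVlow hVconj hΘpos
    hCkD (by positivity) hrμ hkD hkQ hvalb hsmallκ X s hX
  -- `0 ≤ s` off `hX`; the sign of `A_V` off the value letter at the ZERO source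
  obtain ⟨b₀⟩ : Nonempty (PBond (F.P K) 0) := ⟨⟨Classical.arbitrary _, ⟨0, by rw [T3Family.P_d]; norm_num⟩⟩⟩
  have hs : 0 ≤ s := (norm_nonneg _).trans (hX b₀)
  have hb := hvalb (fun _ => 0) (iterBlockOf (K - n) b₀.src) (fun b hb => absurd rfl hb) 1 zero_le_one (fun _ => by rw [norm_zero]; exact zero_le_one) b₀
  rw [one_mul] at hb
  have hAV0 := (mul_nonneg_iff_of_pos_right (Real.exp_pos _)).mp ((norm_nonneg _).trans hb)
  have hV0 : 0 ≤ (2 * (1 + 1 / (min r (1 / 4) / 2))) ^ 3 := by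
    have hk1 : 0 < (min r (1 / 4) / 2) := by have := lt_min hr (by norm_num : (0 : ℝ) < 1 / 4); positivity
    positivity
  have mono := CN_mono (Cg := exists_curved_localGradient.choose) (ε₀ := ε₀)
    (cε := (2 + 2 * Real.sqrt 2 * (4 * ε₀ * (3 + 2457 * norm_bgOfCfg_axialT_sub_le.choose)) + (24 * Real.sqrt 10 + 48) * (48 * ε₀) ^ 2))
    (lAV := hAV) (lWD := hWD) (lWQ := hWQ)
    (l51 := exp_mul_kappa_le (r := r) (by norm_num : (0 : ℝ) ≤ 51))
    (l5 := exp_mul_kappa_le (r := r) (by norm_num : (0 : ℝ) ≤ 5))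
    hCg (by positivity) hε₀.le hAV0 (Real.exp_pos _).le (Real.exp_pos _).le
    (by exact mul_nonneg (mul_nonneg (mul_nonneg hCkD (Real.sqrt_nonneg _)) (div_nonneg (by positivity) hΘpos.le)) hS30)
    (by exact mul_nonneg (mul_nonneg (by positivity) (div_nonneg (by positivity) hΘpos.le)) hS30)
  exact main.trans (mul_le_mul_of_nonneg_right (mul_le_mul_of_nonneg_right mono hV0) hs)

end Member

/-! ## §2 (∇0) for all members, L-only constants (no room) -/

set_option maxHeartbeats 400000 in
/-- ★★★ **(∇0) FOR ALL MEMBERS WITH ROOM, L-ONLY CONSTANTS** — px17 g12's `hG0` letter (the (115)-gradient row of `G₀` on sup-bounded sources) for every `L > 1`, every member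
`i : Idx L`, every printed-regular background below the cap, under `Lift`, in the coupling window, given the member's no-wrap room; `∃ αG BG : ℕ → ℝ` with the three windows of record.
[cite: Balaban1985BackgroundPropagators, (3.3) p.391, Thm 3.3 (3.47)–(3.48) p.398, Thm 3.1 (3.42) p.397, Thm 3.11 p.416, Thm 3.12 p.423; Balaban1985Variational, Thm 1 p.279, (115) p.294] -/
theorem gradient_GT_DeltaEtaSlot_family_allMembers (c₀ cB : ℕ → ℝ) [hc₀ : ∀ L : ℕ, Fact (0 < c₀ L)] [hcB : ∀ L : ℕ, Fact (0 < cB L)] {a₀ a₁ : ℝ} (ha₀ : 0 < a₀) (ha₀₁ : a₀ ≤ a₁) :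
    ∃ (αG BG : ℕ → ℝ),
      (∀ L : ℕ, 1 < L → 0 < αG L) ∧ (∀ L : ℕ, 1 < L → 10 ^ 12 * (L : ℝ) ^ 3 * αG L ≤ 1) ∧ (∀ L : ℕ, 1 < L → 10 ^ 10 * (L : ℝ) ^ 6 * αG L ≤ 1) ∧
      (∀ L : ℕ, 1 < L → 13 * 10 ^ 14 * (L : ℝ) ^ 3 * αG L ≤ 1) ∧ (∀ L : ℕ, 1 < L → 0 ≤ BG L) ∧
    ∀ (L : ℕ), 1 < L → ∀ (i : T3Thm1Carrier.Idx L) (U₀ : GaugeField (i.1.1.P i.1.2.2) 0 (Matrix.specialUnitaryGroup (Fin 2) ℂ)), ∀ ρ : ℝ, RegPr i.1.1 i.1.2.1 i.1.2.2 ρ U₀ → ρ ≤ αG L →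
        (∀ cf : Site (i.1.1.P i.1.2.2) (i.1.2.2 - i.1.2.1) → Matrix (Fin 2) (Fin 2) ℂ,
        (∀ e' : PBond (i.1.1.P i.1.2.2) (i.1.2.2 - i.1.2.1), cf e'.src = ((emlIterU (i.1.2.2 - i.1.2.1) (bgUnits i.1.1 i.1.2.2 U₀) e' : (Matrix (Fin 2) (Fin 2) ℂ)ˣ) : Matrix (Fin 2) (Fin 2) ℂ) * cf e'.tgt *
        (((emlIterU (i.1.2.2 - i.1.2.1) (bgUnits i.1.1 i.1.2.2 U₀) e')⁻¹ : (Matrix (Fin 2) (Fin 2) ℂ)ˣ) : Matrix (Fin 2) (Fin 2) ℂ)) →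
        ∃ l₀ : Site (i.1.1.P i.1.2.2) 0 → Matrix (Fin 2) (Fin 2) ℂ,
        (∀ b' : PBond (i.1.1.P i.1.2.2) 0, l₀ b'.src = ((bgUnits i.1.1 i.1.2.2 U₀ b' : (Matrix (Fin 2) (Fin 2) ℂ)ˣ) : Matrix (Fin 2) (Fin 2) ℂ) * l₀ b'.tgt * (((bgUnits i.1.1 i.1.2.2 U₀ b')⁻¹ : (Matrix (Fin 2) (Fin 2) ℂ)ˣ) : Matrix (Fin 2) (Fin 2) ℂ)) ∧
        ∀ y : Site (i.1.1.P i.1.2.2) (i.1.2.2 - i.1.2.1), l₀ (embIter (i.1.2.2 - i.1.2.1) y) = cf y) →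
      ∀ a : ℝ, a₀ * (c₀ L / cB L) * ((i.1.1.L : ℝ) ^ (i.1.2.2 - i.1.2.1)) ^ 3 ≤ a → a ≤ a₁ * (c₀ L / cB L) * ((i.1.1.L : ℝ) ^ (i.1.2.2 - i.1.2.1)) ^ 3 →
      ∀ (X : PBond (i.1.1.P i.1.2.2) 0 → Matrix (Fin 2) (Fin 2) ℂ) (s : ℝ), (∀ b, ‖X b‖ ≤ s) →
        ‖nabla115 (((i.1.1.L : ℝ)⁻¹) ^ (i.1.2.2 - i.1.2.1)) (bgOfCfg i.1.1 i.1.2.2 U₀)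
            (fun q : Bond 3 (periodsT3 i.1.1 i.1.2.2) => (toL2 i.1.1 i.1.2.2 (c₀ L)).symm (GT i.1.1 i.1.2.1 i.1.2.2 i.2.2.le (c₀ L) (cB L) a
              (DeltaEtaSlot i.1.1 i.1.2.1 i.1.2.2 (c₀ L)) U₀ (toL2 i.1.1 i.1.2.2 (c₀ L) X)) ((bondEquiv i.1.1 i.1.2.2).symm q))‖
          ≤ BG L * s := by
  obtain ⟨αco, γco, hαco, hWco, hwinco, hγco, hco⟩ := hco_DeltaEtaSlot_exists c₀ cB ha₀
  obtain ⟨αK, CK, δK, hαK, hWK, hCK, hδK, hkD⟩ := kernelRow349_allMembers_exists c₀ cB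
  -- the L-only choices
  set CV1 : ℝ := 32 * Real.sqrt 2 * 648 + (33 / 8 : ℝ) ^ 2 * (600 * (27 / 4 : ℝ) ^ 6) with hCV1
  have hCV1pos : 0 < CV1 := by rw [hCV1]; positivity
  have ha₁ : 0 ≤ a₁ := le_trans ha₀.le ha₀₁
  set T : ℕ → ℝ := fun L => 5000 * a₁ + 27 * Real.sqrt 2 * CK L * (2 * (1 + 4 / δK L)) ^ 3 / min 1 (δK L / 4) with hT
  set ε : ℕ → ℝ := fun L => min (1 / 8) (γco L / (8 * CV1)) with hε
  set r : ℕ → ℝ := fun L => min (min (1 / 4) (δK L / 2)) (min (γco L * ε L / 48) (γco L / (16 * (T L + 1)))) with hr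
  set Mg : ℝ := exists_curved_localGradient.choose * (48 * (6 * Real.sqrt 2 * Real.sqrt 10 + 6 * Real.sqrt 2)) * Real.exp (51 / 8) with hMg
  have hMg0 : 0 ≤ Mg := by have := exists_curved_localGradient.choose_spec.1; rw [hMg]; positivity
  set αG : ℕ → ℝ := fun L => min (min (min (αco L) (αK L)) (min ((10 ^ 10 * (L : ℝ) ^ 6)⁻¹) (γco L / (16 * 10 ^ 5)))) (2 * Mg + 1)⁻¹ with hαG
  have hT0 : ∀ L, 1 < L → 0 ≤ T L := fun L hL => by
    have := hCK L hL; have := hδK L hL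
    simp only [hT]; positivity
  have hε0 : ∀ L, 1 < L → 0 < ε L := fun L hL => by
    have := hγco L hL; simp only [hε]; exact lt_min (by norm_num) (by positivity)
  have hr0 : ∀ L, 1 < L → 0 < r L := fun L hL => by
    have := hγco L hL; have := hδK L hL; have := hε0 L hL; have := hT0 L hL
    simp only [hr]; exact lt_min (lt_min (by norm_num) (by positivity)) (lt_min (by positivity) (by positivity))
  have hαG0 : ∀ L, 1 < L → 0 < αG L := fun L hL => by
    have := hγco L hL; have := hαco L hL; have := hαK L hL
    have hL0 : (0 : ℝ) < L := by exact_mod_cast lt_trans zero_lt_one hL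
    simp only [hαG]; exact lt_min (lt_min (lt_min (by assumption) (by assumption)) (lt_min (by positivity) (by positivity))) (by positivity)
  refine ⟨αG,
    fun L => (2 * ((exists_curved_localGradient.choose * (((Real.sqrt 2 * (2 * ((Real.sqrt 2 + Real.sqrt 2 * ((50 * a₁ * Real.exp (δK L) + CK L) * (3 * Real.sqrt 2) * (Real.exp (6 * r L) * (2 / γco L)) * (2 * (1 + 2 / δK L)) ^ 3)) * (8 * Real.exp (3 * r L)) * 14 + 36 * (Real.sqrt (8 * Real.exp (3 * r L) * (2 * (1 + 1 / r L)) ^ 3) * (Real.exp (6 * r L) * (2 / γco L)))))) * Real.exp (51 / 8)) * (2 + 2 * Real.sqrt 2 * (4 * αG L * (3 + 2457 * norm_bgOfCfg_axialT_sub_le.choose)) + (24 * Real.sqrt 10 + 48) * (48 * αG L) ^ 2) + (Real.sqrt 2 * ((32 * αG L * ((2 * ((Real.sqrt 2 + Real.sqrt 2 * ((50 * a₁ * Real.exp (δK L) + CK L) * (3 * Real.sqrt 2) * (Real.exp (6 * r L) * (2 / γco L)) * (2 * (1 + 2 / δK L)) ^ 3)) * (8 * Real.exp (3 * r L)) * 14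 + 36 * (Real.sqrt (8 * Real.exp (3 * r L) * (2 * (1 + 1 / r L)) ^ 3) * (Real.exp (6 * r L) * (2 / γco L))))) * Real.exp (5 / 8))) + (CK L * (3 * Real.sqrt 2) * (Real.exp (6 * r L) * (2 / γco L)) * (2 * (1 + 2 / δK L)) ^ 3) + ((50 * a₁ * Real.exp (δK L)) * (3 * Real.sqrt 2) * (Real.exp (6 * r L) * (2 / γco L)) * (2 * (1 + 2 / δK L)) ^ 3) + 1)) * Real.exp (51 / 8)) + 2 * Real.sqrt 2 * (48 * αG L) * ((Real.sqrt 2 * (2 * ((Real.sqrt 2 + Real.sqrt 2 * ((50 * a₁ * Real.exp (δK L) + CK L) * (3 * Real.sqrt 2) * (Real.exp (6 * r L) * (2 / γco L)) * (2 * (1 + 2 / δK L)) ^ 3)) * (8 * Real.exp (3 * r L)) * 14 + 36 * (Real.sqrt (8 * Real.exp (3 * r L) * (2 * (1 + 1 / r L)) ^ 3) * (Real.exp (6 * r L) * (2 / γco L)))))) * Real.exp (51 / 8))))) * (2 * (1 + 1 / (min (r L) (1 / 4) / 2))) ^ 3,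
    hαG0, fun L hL => ?_, fun L hL => ?_, fun L hL => ?_, fun L hL => ?_, ?_⟩
  · -- window `10¹²L³`
    have h1 : αG L ≤ αco L := by simp only [hαG]; exact ((min_le_left _ _).trans (min_le_left _ _)).trans (min_le_left _ _)
    have hL0 : (0 : ℝ) < L := by exact_mod_cast lt_trans zero_lt_one hL
    exact (mul_le_mul_of_nonneg_left h1 (by positivity)).trans (hWco L hL)
  · -- window `10¹⁰L⁶`
    have hL0 : (0 : ℝ) < L := by exact_mod_cast lt_trans zero_lt_one hL
    have h1 : αG L ≤ (10 ^ 10 * (L : ℝ) ^ 6)⁻¹ := by simp only [hαG]; exact ((min_le_left _ _).trans (min_le_right _ _)).trans (min_le_left _ _)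
    calc 10 ^ 10 * (L : ℝ) ^ 6 * αG L ≤ 10 ^ 10 * (L : ℝ) ^ 6 * (10 ^ 10 * (L : ℝ) ^ 6)⁻¹ := mul_le_mul_of_nonneg_left h1 (by positivity)
      _ = 1 := mul_inv_cancel₀ (by positivity)
  · -- window `13·10¹⁴L³`
    have h1 : αG L ≤ αco L := by simp only [hαG]; exact ((min_le_left _ _).trans (min_le_left _ _)).trans (min_le_left _ _)
    have hL0 : (0 : ℝ) < L := by exact_mod_cast lt_trans zero_lt_one hL
    exact (mul_le_mul_of_nonneg_left h1 (by positivity)).trans (hwinco L hL)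
  · -- `0 ≤ BG L`
    have := hγco L hL; have := hCK L hL; have := hδK L hL; have := hr0 L hL; have := hαG0 L hL
    have := exists_curved_localGradient.choose_spec.1; have := norm_bgOfCfg_axialT_sub_le.choose_spec.1
    have hk1 : 0 < min (r L) (1 / 4) / 2 := div_pos (lt_min (hr0 L hL) (by norm_num)) two_pos
    positivity
  -- the member
  intro L hL i U₀ ρ hreg hρ hlift a ha₀a ha₁a X s hX
  have hγ := hγco L hL
  have hCKL := hCK L hL
  have hδKL := hδK L hL
  have hεL := hε0 L hL
  have hrL := hr0 L hL
  have hTL := hT0 L hL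
  have hαL := hαG0 L hL
  have hc₀L : 0 < c₀ L := (hc₀ L).out
  have hcBL : 0 < cB L := (hcB L).out
  have hL0 : (0 : ℝ) < L := by exact_mod_cast lt_trans zero_lt_one hL
  have hLL : (L : ℝ) = (i.1.1.L : ℝ) := by rw [i.2.1]
  -- the cap and its windows at this member (`F.L = L`)
  have hαco' : αG L ≤ αco L := by simp only [hαG]; exact ((min_le_left _ _).trans (min_le_left _ _)).trans (min_le_left _ _)
  have hαK' : αG L ≤ αK L := by simp only [hαG]; exact ((min_le_left _ _).trans (min_le_left _ _)).trans (min_le_right _ _)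
  have hαγ' : αG L ≤ γco L / (16 * 10 ^ 5) := by simp only [hαG]; exact ((min_le_left _ _).trans (min_le_right _ _)).trans (min_le_right _ _)
  have hαM' : αG L ≤ (2 * Mg + 1)⁻¹ := by simp only [hαG]; exact min_le_right _ _
  have hW1 : 10 ^ 12 * (i.1.1.L : ℝ) ^ 3 * αG L ≤ 1 := by
    rw [← hLL]; exact (mul_le_mul_of_nonneg_left hαco' (by positivity)).trans (hWco L hL)
  have hW2 : 10 ^ 10 * (i.1.1.L : ℝ) ^ 6 * αG L ≤ 1 := by
    rw [← hLL]
    have h1 : αG L ≤ (10 ^ 10 * (L : ℝ) ^ 6)⁻¹ := by simp only [hαG]; exact ((min_le_left _ _).trans (min_le_right _ _)).trans (min_le_left _ _)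
    calc 10 ^ 10 * (L : ℝ) ^ 6 * αG L ≤ 10 ^ 10 * (L : ℝ) ^ 6 * (10 ^ 10 * (L : ℝ) ^ 6)⁻¹ := mul_le_mul_of_nonneg_left h1 (by positivity)
      _ = 1 := mul_inv_cancel₀ (by positivity)
  have hW3 : 13 * 10 ^ 14 * (i.1.1.L : ℝ) ^ 3 * αG L ≤ 1 := by
    rw [← hLL]; exact (mul_le_mul_of_nonneg_left hαco' (by positivity)).trans (hwinco L hL)
  have hregG : RegPr i.1.1 i.1.2.1 i.1.2.2 (αG L) U₀ := regPr_mono i.1.1 hρ hreg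
  have hregK : RegPr i.1.1 i.1.2.1 i.1.2.2 (αK L) U₀ := regPr_mono i.1.1 (hρ.trans hαK') hreg
  -- (γ) at this member
  have hco' := hco L hL i U₀ ρ hreg (hρ.trans hαco') hlift a ha₀a
  -- hk_D at this member, in `R_S`-text under `Lift`
  obtain ⟨Q'', D', hint, hD', htop, hseq, hker⟩ :=
    exists_intertwiner_of_regPr i.1.1 i.2.2.le (c₀ := c₀ L) (cB L) hαL hW1 U₀ hregG
  have hRS : RS i.1.1 i.1.2.1 i.1.2.2 i.2.2.le (c₀ L) (cB L) U₀ = projR (covLapSite i.1.1 i.1.2.1 i.1.2.2 (c₀ L) U₀) Q'' :=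
    (RS_eq_projR_iff_lift i.1.1 i.2.2.le (cB L) hαL hW1 U₀ hregG Q'' htop hker).2 hlift
  have hkD' := hkD L hL i U₀ hregK Q'' htop hker
  rw [← hRS, hLL] at hkD'
  -- the coupling window gives `0 ≤ a`
  have ha : 0 ≤ a := le_trans (by positivity) ha₀a
  -- the budgets
  have hε8 : ε L ≤ 1 / 8 := by simp only [hε]; exact min_le_left _ _
  have hεC : ε L * CV1 ≤ γco L / 8 := by
    have h1 : ε L ≤ γco L / (8 * CV1) := by simp only [hε]; exact min_le_right _ _
    calc ε L * CV1 ≤ γco L / (8 * CV1) * CV1 := mul_le_mul_of_nonneg_right h1 hCV1pos.le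
      _ = γco L / 8 := by field_simp
  have hr4 : r L ≤ 1 / 4 := by simp only [hr]; exact (min_le_left _ _).trans (min_le_left _ _)
  have hrδ : r L ≤ δK L / 2 := by simp only [hr]; exact (min_le_left _ _).trans (min_le_right _ _)
  have hrγ : r L ≤ γco L * ε L / 48 := by simp only [hr]; exact (min_le_right _ _).trans (min_le_left _ _)
  have hrT : r L * T L ≤ γco L / 16 := by
    have h1 : r L ≤ γco L / (16 * (T L + 1)) := by simp only [hr]; exact (min_le_right _ _).trans (min_le_right _ _)
    calc r L * T L ≤ r L * (T L + 1) := mul_le_mul_of_nonneg_left (by linarith) hrL.le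
      _ ≤ γco L / (16 * (T L + 1)) * (T L + 1) := mul_le_mul_of_nonneg_right h1 (by linarith)
      _ = γco L / 16 := by field_simp
  have hαγ : 10 ^ 5 * αG L ≤ γco L / 16 := by
    calc 10 ^ 5 * αG L ≤ 10 ^ 5 * (γco L / (16 * 10 ^ 5)) := mul_le_mul_of_nonneg_left hαγ' (by positivity)
      _ = γco L / 16 := by field_simp
  -- the gradient margin from the cap: `C_g·(48αG·M)·e^{51∕8} = αG·Mg ≤ Mg∕(2Mg+1) ≤ ½`
  have hsmall : exists_curved_localGradient.choose * ((48 * αG L) * (6 * Real.sqrt 2 * Real.sqrt 10 + 6 * Real.sqrt 2)) * Real.exp (51 / 8) ≤ 1 / 2 := by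
    have e : exists_curved_localGradient.choose * ((48 * αG L) * (6 * Real.sqrt 2 * Real.sqrt 10 + 6 * Real.sqrt 2)) * Real.exp (51 / 8) = αG L * Mg := by
      rw [hMg]; ring
    rw [e]
    have h1 : αG L * Mg ≤ (2 * Mg + 1)⁻¹ * Mg := mul_le_mul_of_nonneg_right hαM' hMg0
    have h2 : (2 * Mg + 1)⁻¹ * Mg ≤ 1 / 2 := by
      rw [inv_mul_le_iff₀ (by positivity)]; linarith
    exact h1.trans h2
  have hmain := gradient_GT_DeltaEtaSlot_kfree_allMembers i.1.1 i.2.2.le (c₀ L) (cB L) i.2.2 hαL hW1 hW2 hW3 U₀ hregG hlift ha ha₁a hγ hco' hCKL hδKL hkD'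
    hrL hr4 hrδ hεL hε8 hεC hrγ (by simp only [hT] at hrT; exact hrT) hαγ hsmall X s hX
  exact hmain

end Summit.QuantumFields.YangMills.Theorems.Prop7OneFormGreenBlockGradientFamilyAllMembers

end
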